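import Literature.RingTheory.Flat.FibrewiseCriterionProofs
import Literature.AlgebraicGeometry.Morphisms.FibreChartRing
import Mathlib.AlgebraicGeometry.Morphisms.Flat
import Mathlib.AlgebraicGeometry.Morphisms.FinitePresentation
import Mathlib.RingTheory.TensorProduct.Quotient
import Mathlib.RingTheory.RingHom.Flat
import HarnessLib

/-!
# Flatness from flatness of the fibres over a local base (EGA IV₃ 11.3.10, scheme form of Stacks 05UV)

Topic `Literature/AlgebraicGeometry/Morphisms`, namespace `Literature.AlgebraicGeometry.Morphisms`.
THEOREMS ONLY (no definition, no named fact; net Literature debt 0).  Cell `hodgecm-mathlib` (D-0151),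
fan A-II (h21), EDITION E2 «height-one road» for the degree-one Shimura–Taniyama congruence, piece DEG (a)
«`ν(λ̃) = ν(λ)`» ([Shimura1998] §11.1 Prop. 12, last clause): the generic flatness step that makes the
extension `Λ : 𝒜 → ℬ` of an isogeny to the smooth proper models finite locally free, so that its degree is
constant along the base.

THE PRINT.  EGA IV₃ Thm. 11.3.10 / The Stacks Project, Tag 039D («critère de platitude par fibres» for
schemes): let `S` be a scheme, `f : X → Y` a morphism of `S`-schemes with `X` flat and locally of finite
presentation over `S` and `Y` locally of finite type over `S`; if for a point `s ∈ S` the fibre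
`f_s : X_s → Y_s` is flat, then `f` is flat at every point of `X` lying over `s`.  The commutative algebra —
Tag 05UV — is the tree's PROVED `Literature.RingTheory.Flat.Stacks05UV_holds`
(`RingTheory/Flat/FibrewiseCriterionProofs.lean`); this file is the affine-local reduction of the scheme
statement to it, over a LOCAL base `S = Spec R` and its closed point (which is the case consumed), with the
closed fibre presented as the base change along any surjection `R → κ` onto a field (so that consumers may
use their own residue-field model, e.g. `𝓞_K / v` rather than `IsLocalRing.ResidueField`).

WHAT IS HERE:
* `flat_quotient_tensor_of_flat_tensor_map` — algebra: for `R → κ ≅ R ⧸ I` and an `R`-algebra map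
  `B → B'`, flatness of `κ ⊗_R B → κ ⊗_R B'` gives flatness of `B'/IB'` over `B/IB` in the `(B ⧸ IB) ⊗_B B'`
  form consumed by Tag 05UV;
* `flat_localRingHom_of_flat` — algebra: `B'_{q'}` flat over `B` ⇒ `B_q → B'_{q'}` flat (`q = q' ∩ B`);
* **`flat_stalkMap_of_flat_closedFibre`** — for `f : X → Y` over `Spec R` (`R` local; `Y` locally of
  finite type, `X` flat and locally of finite presentation over `R`) whose closed-fibre map
  `X ×_R κ → Y ×_R κ` is flat, the stalk map `𝒪_{Y,f x} → 𝒪_{X,x}` is flat at every `x` over the closed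
  point (EGA IV₃ 11.3.10 at the closed point of a local base);
* **`flat_of_flat_fibres`** — over a local domain of dimension `≤ 1` whose generic point `Spec K → Spec R`
  is an open immersion (a discrete valuation ring: the tree's `isOpenImmersion_specGenericPoint`), flatness
  of the two fibre maps gives `Flat f` (over the open generic point, flatness is that of the base change —
  private `flat_stalkMap_of_flat_pullback_of_isOpenImmersion`).

Proof of the main theorem: choose affine opens `f x ∈ V = Spec B ⊆ Y`, `x ∈ U = Spec B' ⊆ f⁻¹V`; `B` is
of finite type, `B'` finitely presented and flat over `R` (`HasRingHomProperty.appLE`); the closed-fibre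
map restricted to the affine charts `κ ⊗_R B → κ ⊗_R B'` of the fibres (`Morphisms/FibreChartRing`,
`fibreChartIso`) is flat, hence so is `B/𝔪B → B'/𝔪B'`; Tag 05UV at the prime `q'` of `x` (which contains
`𝔪B'` because `x` lies over the closed point) gives `B'_{q'}` flat over `B`, i.e. the stalk map is flat
(`IsAffineOpen.arrowStalkMapIso`).

## References
* [EGAIV3] A. Grothendieck, J. Dieudonné, *EGA IV₃*, Publ. Math. IHÉS 28 (1966), Thm. 11.3.10.
* [StacksProject] The Stacks Project, Tags 00MP, 00R7, 05UV (algebra), 039A–039E (schemes).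
* [Shimura1998] G. Shimura, *Abelian Varieties with Complex Multiplication and Modular Functions*,
  Princeton 1998, §11.1 Prop. 12 (p. 84): «If A and B have the same dimension, we have `ν(λ) = ν(λ̃)`» —
  the consumer (`Motives/AbelianVarietyGoodReductionHomDegree`).
-/

noncomputable section

-- `TopCat.Presheaf` is not reducible (as in Mathlib's `AlgebraicGeometry/Modules` and the tree's
-- `Morphisms/FibreChartRing`, whose charts are used below).
set_option backward.isDefEq.respectTransparency false

open TensorProduct IsLocalRing CategoryTheory CategoryTheory.Limits AlgebraicGeometry

universe u

namespace Literature.AlgebraicGeometry.Morphisms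

/-! ## §0 Two pieces of commutative algebra -/

section Algebra

variable {R : Type u} [CommRing R] {κ : Type u} [CommRing κ] [Algebra R κ]
  {B B' : Type u} [CommRing B] [CommRing B'] [Algebra R B] [Algebra R B'] [Algebra B B']
  [IsScalarTower R B B']

/-- **The fibre-flatness hypothesis of Tag 05UV from the `κ ⊗_R (-)` form.**  Let `I ⊆ R` be an ideal with
`R ⧸ I ≅ κ` as `R`-algebras and `B → B'` a map of `R`-algebras.  If `κ ⊗_R B → κ ⊗_R B'` is flat, then
`(B ⧸ IB) ⊗_B B'` (`= B' ⧸ IB'`) is flat over `B ⧸ IB`: the two maps are isomorphic through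
`B ⧸ IB ≅ (R ⧸ I) ⊗_R B ≅ κ ⊗_R B` and `κ ⊗_R B' ≅ B' ⧸ IB' ≅ (B ⧸ IB) ⊗_B B'`
(Mathlib `Algebra.TensorProduct.quotIdealMapEquivQuotTensor`). [cite: StacksProject, Tag 05UV] -/
theorem flat_quotient_tensor_of_flat_tensor_map (I : Ideal R) (e : (R ⧸ I) ≃ₐ[R] κ)
    (h : (Algebra.TensorProduct.map (AlgHom.id R κ)
      (IsScalarTower.toAlgHom R B B')).toRingHom.Flat) :
    Module.Flat (B ⧸ I.map (algebraMap R B)) ((B ⧸ I.map (algebraMap R B)) ⊗[B] B') := by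
  -- `α : B ⧸ 𝔪B ≃ κ ⊗[R] B`
  let α : (B ⧸ I.map (algebraMap R B)) ≃ₐ[R] κ ⊗[R] B :=
    ((Algebra.TensorProduct.quotIdealMapEquivQuotTensor B I).restrictScalars R).trans
      (Algebra.TensorProduct.congr e AlgEquiv.refl)
  -- `β : κ ⊗[R] B' ≃ (B ⧸ J) ⊗[B] B'`
  have hJ' : (I.map (algebraMap R B)).map (algebraMap B B') = I.map (algebraMap R B') := by
    rw [Ideal.map_map, ← IsScalarTower.algebraMap_eq]
  let β : κ ⊗[R] B' ≃+* (B ⧸ I.map (algebraMap R B)) ⊗[B] B' :=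
    ((Algebra.TensorProduct.congr e (AlgEquiv.refl (A₁ := B'))).symm.toRingEquiv.trans
      ((Algebra.TensorProduct.quotIdealMapEquivQuotTensor B' I).symm.toRingEquiv.trans
        ((Ideal.quotientEquivAlgOfEq R hJ'.symm).toRingEquiv.trans
          (Algebra.TensorProduct.quotIdealMapEquivQuotTensor B' (I.map (algebraMap R B))).toRingEquiv)))
  have key : algebraMap (B ⧸ I.map (algebraMap R B)) ((B ⧸ I.map (algebraMap R B)) ⊗[B] B') =
      β.toRingHom.comp ((Algebra.TensorProduct.map (AlgHom.id R κ)
        (IsScalarTower.toAlgHom R B B')).toRingHom.comp α.toRingEquiv.toRingHom) := by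
    have hα : ∀ b : B, α (Ideal.Quotient.mk _ b) = 1 ⊗ₜ[R] b := fun b => by
      simp only [α, AlgEquiv.trans_apply, AlgEquiv.restrictScalars_apply]
      rw [Algebra.TensorProduct.quotIdealMapEquivQuotTensor_mk, Algebra.TensorProduct.congr_apply,
        Algebra.TensorProduct.map_tmul, map_one]
      rfl
    have hβ : ∀ b' : B', β (1 ⊗ₜ[R] b') = 1 ⊗ₜ[B] b' := fun b' => by
      have h1 : (Algebra.TensorProduct.congr e (AlgEquiv.refl (R := R) (A₁ := B'))).symm
          (1 ⊗ₜ[R] b') = 1 ⊗ₜ[R] b' := by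
        rw [AlgEquiv.symm_apply_eq, Algebra.TensorProduct.congr_apply,
          Algebra.TensorProduct.map_tmul, map_one]
        rfl
      have h2 : (Algebra.TensorProduct.quotIdealMapEquivQuotTensor B' I).symm (1 ⊗ₜ[R] b') =
          Ideal.Quotient.mk _ b' := by
        rw [AlgEquiv.symm_apply_eq, Algebra.TensorProduct.quotIdealMapEquivQuotTensor_mk]
      simp only [β, RingEquiv.trans_apply, AlgEquiv.coe_ringEquiv, h1,
        h2, Ideal.quotientEquivAlgOfEq_mk, Algebra.TensorProduct.quotIdealMapEquivQuotTensor_mk]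
    refine Ideal.Quotient.ringHom_ext (RingHom.ext fun b => ?_)
    simp only [RingHom.comp_apply, AlgHom.toRingHom_eq_coe, RingHom.coe_coe,
      RingEquiv.toRingHom_eq_coe, AlgEquiv.coe_ringEquiv, hα, Algebra.TensorProduct.map_tmul,
      AlgHom.id_apply, IsScalarTower.toAlgHom_apply, hβ]
    rw [Algebra.TensorProduct.algebraMap_apply, Algebra.algebraMap_self, RingHom.id_apply]
    show (algebraMap B (B ⧸ _) b) ⊗ₜ[B] (1 : B') = (1 : B ⧸ _) ⊗ₜ[B] (algebraMap B B' b)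
    rw [Algebra.algebraMap_eq_smul_one, Algebra.algebraMap_eq_smul_one, TensorProduct.smul_tmul]
  rw [← RingHom.flat_algebraMap_iff, key]
  exact (RingHom.Flat.comp (RingHom.Flat.of_bijective α.toRingEquiv.bijective) h).comp
    (RingHom.Flat.of_bijective β.bijective)

/-- **`B'_{q'}` flat over `B` ⇒ `B_q → B'_{q'}` flat** (`q = q' ∩ B`): a `B_q`-module which is flat over `B`
is flat over `B_q` (it is its own localisation; Mathlib `Module.Flat.of_isLocalizedModule`).  This turns
the conclusion of Tag 05UV into flatness of the induced local homomorphism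
`Localization.localRingHom q q'`, the shape of a stalk map (`IsAffineOpen.arrowStalkMapIso`).
[cite: StacksProject, Tag 05UV] -/
theorem flat_localRingHom_of_flat {B B' : Type u} [CommRing B] [CommRing B'] [Algebra B B']
    (q' : Ideal B') [q'.IsPrime] (q : Ideal B) [q.IsPrime] (hq : q = q'.comap (algebraMap B B'))
    (h : Module.Flat B (Localization.AtPrime q')) :
    (Localization.localRingHom q q' (algebraMap B B') hq).Flat := by
  letI algψ : Algebra (Localization.AtPrime q) (Localization.AtPrime q') :=
    (Localization.localRingHom q q' (algebraMap B B') hq).toAlgebra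
  haveI : IsScalarTower B (Localization.AtPrime q) (Localization.AtPrime q') :=
    IsScalarTower.of_algebraMap_eq fun b => by
      rw [RingHom.algebraMap_toAlgebra, Localization.localRingHom_to_map,
        IsScalarTower.algebraMap_apply B B' (Localization.AtPrime q')]
  haveI : IsLocalizedModule q.primeCompl
      (LinearMap.id : Localization.AtPrime q' →ₗ[B] Localization.AtPrime q') :=
    isLocalizedModule_id q.primeCompl (Localization.AtPrime q') (Localization.AtPrime q)
  exact Module.Flat.of_isLocalizedModule (Localization.AtPrime q) q.primeCompl
    (LinearMap.id : Localization.AtPrime q' →ₗ[B] Localization.AtPrime q')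

end Algebra

/-! ## §1 EGA IV₃ 11.3.10 at the closed point of a local base -/

/-- `appLE` along an equality of morphisms (bookkeeping). [folklore] -/
private theorem appLE_congr {X Y : Scheme.{u}} {f g : X ⟶ Y} (h : f = g) (U : Y.Opens) (V : X.Opens)
    (e : V ≤ f ⁻¹ᵁ U) : f.appLE U V e = g.appLE U V (h ▸ e) := by
  subst h; rfl

variable {R : Type u} [CommRing R] [IsLocalRing R] {κ : Type u} [Field κ] [Algebra R κ]

open ChartRing in
/-- **Critère de platitude par fibres at the closed point of a local base** (EGA IV₃ Thm. 11.3.10; The Stacks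
Project, Tag 039D, from the algebra Tag 05UV = the tree's `Stacks05UV_holds`).  Let `R` be a local ring and
`R → κ` a surjection onto a field (a model of the residue field), `X`, `Y` schemes over `Spec R` with `Y`
locally of finite type and `X` flat and locally of finite presentation over `R`, and `f : X → Y` an
`R`-morphism whose closed-fibre map `X ×_R κ → Y ×_R κ` (`Over.pullback` along `Spec κ → Spec R`) is flat.
Then for every point `x` of `X` over the closed point of `Spec R`, the stalk map `𝒪_{Y, f x} → 𝒪_{X, x}` is
flat.  [cite: EGAIV3, Thm. 11.3.10] [cite: StacksProject, Tag 05UV] -/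
theorem flat_stalkMap_of_flat_closedFibre (hκ : Function.Surjective (algebraMap R κ))
    {X Y : Over (Spec (CommRingCat.of R))} (f : X ⟶ Y)
    [LocallyOfFiniteType Y.hom] [LocallyOfFinitePresentation X.hom] [Flat X.hom]
    [Flat ((Over.pullback (Spec.map (CommRingCat.ofHom (algebraMap R κ)))).map f).left]
    (x : X.left) (hx : X.hom x = closedPoint R) : (f.left.stalkMap x).hom.Flat := by
  have hw : f.left ≫ Y.hom = X.hom := Over.w f
  have hy : Y.hom (f.left x) = closedPoint R := by
    rw [← Scheme.Hom.comp_apply, hw, hx]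
  -- affine opens `f x ∈ V ⊆ Y`, `x ∈ U ⊆ f⁻¹ V`
  obtain ⟨_, ⟨V, hV, rfl⟩, hyV, -⟩ :=
    Y.left.isBasis_affineOpens.exists_subset_of_mem_open (Set.mem_univ (f.left x)) isOpen_univ
  obtain ⟨_, ⟨U, hU, rfl⟩, hxU, hUV⟩ :=
    X.left.isBasis_affineOpens.exists_subset_of_mem_open (show x ∈ (f.left ⁻¹ᵁ V : Set X.left) from hyV)
      (f.left ⁻¹ᵁ V).isOpen
  have hV : IsAffineOpen V := hV
  have hU : IsAffineOpen U := hU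
  have hUV : U ≤ f.left ⁻¹ᵁ V := hUV
  -- the coordinate rings as `R`-algebras and the map `g = f^♯ : B → B'`
  have happ : Y.hom.appLE ⊤ V le_top ≫ f.left.appLE V U hUV = X.hom.appLE ⊤ U le_top := by
    have key : ∀ {g : X.left ⟶ Spec (.of R)} (h : f.left ≫ Y.hom = g) (e : U ≤ (f.left ≫ Y.hom) ⁻¹ᵁ ⊤),
        (f.left ≫ Y.hom).appLE ⊤ U e = g.appLE ⊤ U (h ▸ e) := by
      intro g h e; subst h; rfl
    rw [Scheme.Hom.appLE_comp_appLE]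
    exact key hw _
  letI algBB' : Algebra (ChartRing Y.hom V) (ChartRing X.hom U) :=
    ((ChartRing.mk X.hom U).comp ((f.left.appLE V U hUV).hom.comp ChartRing.val)).toAlgebra
  haveI : IsScalarTower R (ChartRing Y.hom V) (ChartRing X.hom U) :=
    IsScalarTower.of_algebraMap_eq fun r => ChartRing.val_injective X.hom U (by
      change _ = f.left.appLE V U hUV (ChartRing.val (algebraMap R (ChartRing Y.hom V) r))
      rw [ChartRing.val_algebraMap, ChartRing.val_algebraMap, ← happ]
      rfl)
  -- finiteness / flatness hypotheses of Tag 05UV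
  have hFT : Algebra.FiniteType R (ChartRing Y.hom V) := by
    have h1 : (Y.hom.appLE ⊤ V le_top).hom.FiniteType :=
      HasRingHomProperty.appLE @LocallyOfFiniteType Y.hom inferInstance ⟨⊤, isAffineOpen_top _⟩
        ⟨V, hV⟩ le_top
    rw [← RingHom.finiteType_algebraMap]
    exact (RingHom.finiteType_respectsIso.cancel_left_isIso (Scheme.ΓSpecIso (.of R)).inv
      (Y.hom.appLE ⊤ V le_top)).mpr h1
  have hFP : Algebra.FinitePresentation R (ChartRing X.hom U) := by
    have h1 : (X.hom.appLE ⊤ U le_top).hom.FinitePresentation :=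
      HasRingHomProperty.appLE @LocallyOfFinitePresentation X.hom inferInstance
        ⟨⊤, isAffineOpen_top _⟩ ⟨U, hU⟩ le_top
    rw [← RingHom.finitePresentation_algebraMap]
    exact (RingHom.finitePresentation_respectsIso.cancel_left_isIso (Scheme.ΓSpecIso (.of R)).inv
      (X.hom.appLE ⊤ U le_top)).mpr h1
  have hFl : Module.Flat R (ChartRing X.hom U) := by
    have h1 : (X.hom.appLE ⊤ U le_top).hom.Flat :=
      HasRingHomProperty.appLE @Flat X.hom inferInstance ⟨⊤, isAffineOpen_top _⟩ ⟨U, hU⟩ le_top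
    rw [← RingHom.flat_algebraMap_iff]
    exact (RingHom.Flat.respectsIso.cancel_left_isIso (Scheme.ΓSpecIso (.of R)).inv
      (X.hom.appLE ⊤ U le_top)).mpr h1
  -- the closed-fibre square
  set s : Spec (.of κ) ⟶ Spec (.of R) := Spec.map (CommRingCat.ofHom (algebraMap R κ)) with hs
  let pX : ((Over.pullback s).obj X).left ⟶ X.left := pullback.fst X.hom s
  let tX : ((Over.pullback s).obj X).left ⟶ Spec (.of κ) := pullback.snd X.hom s
  let pY : ((Over.pullback s).obj Y).left ⟶ Y.left := pullback.fst Y.hom s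
  let tY : ((Over.pullback s).obj Y).left ⟶ Spec (.of κ) := pullback.snd Y.hom s
  have hPX : IsPullback pX tX X.hom s := IsPullback.of_hasPullback X.hom s
  have hPY : IsPullback pY tY Y.hom s := IsPullback.of_hasPullback Y.hom s
  set fs := ((Over.pullback s).map f).left with hfs
  have hfs₁ : fs ≫ pY = pX ≫ f.left := pullback.lift_fst _ _ _
  have hfs₂ : fs ≫ tY = tX := Over.w ((Over.pullback s).map f)
  have hUs : IsAffineOpen (pX ⁻¹ᵁ U) := isAffineOpen_preimage_of_isPullback X.hom pX tX hPX hU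
  have hVs : IsAffineOpen (pY ⁻¹ᵁ V) := isAffineOpen_preimage_of_isPullback Y.hom pY tY hPY hV
  have hle : pX ⁻¹ᵁ U ≤ fs ⁻¹ᵁ (pY ⁻¹ᵁ V) := by
    rw [← Scheme.Hom.comp_preimage, hfs₁, Scheme.Hom.comp_preimage]
    exact fun z hz => hUV hz
  -- flatness of the closed-fibre map on the charts, transported to `κ ⊗ B → κ ⊗ B'`
  have hflat_s : (fs.appLE (pY ⁻¹ᵁ V) (pX ⁻¹ᵁ U) hle).hom.Flat :=
    HasRingHomProperty.appLE @Flat fs inferInstance ⟨_, hVs⟩ ⟨_, hUs⟩ hle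
  let eX := fibreChartIso X.hom pX tX hPX hU
  let eY := fibreChartIso Y.hom pY tY hPY hV
  let g : ChartRing Y.hom V →ₐ[R] ChartRing X.hom U := IsScalarTower.toAlgHom R _ _
  have hconst : ∀ a : κ, fs.appLE _ _ hle (fibreConst pY tY V a) = fibreConst pX tX U a := by
    intro a
    rw [fibreConst_apply, fibreConst_apply, ← CommRingCat.comp_apply (tY.appLE ⊤ _ le_top),
      Scheme.Hom.appLE_comp_appLE, appLE_congr hfs₂]
  have hsect : ∀ b : ChartRing Y.hom V,
      fs.appLE _ _ hle (pY.app V (ChartRing.val b)) = pX.app U (ChartRing.val (g b)) := by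
    intro b
    have hc : (pX ≫ f.left).appLE V (pX ⁻¹ᵁ U)
        (by rw [Scheme.Hom.comp_preimage]; exact fun z hz => hUV hz) =
        f.left.appLE V U hUV ≫ pX.appLE U (pX ⁻¹ᵁ U) le_rfl :=
      (Scheme.Hom.appLE_comp_appLE _ _ _ _ _ _ _).symm
    rw [Scheme.Hom.app_eq_appLE, Scheme.Hom.app_eq_appLE, ← CommRingCat.comp_apply (pY.appLE V _ _),
      Scheme.Hom.appLE_comp_appLE, appLE_congr hfs₁, hc]
    rfl
  have hsq : ∀ z, fs.appLE _ _ hle (eY z) = eX (Algebra.TensorProduct.map (AlgHom.id R κ) g z) := by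
    intro z
    induction z using TensorProduct.induction_on with
    | zero => simp only [map_zero]
    | add x y hx hy => simp only [map_add, hx, hy]
    | tmul a b =>
      rw [Algebra.TensorProduct.map_tmul, AlgHom.id_apply, fibreChartIso_tmul, fibreChartIso_tmul,
        map_mul, hconst, hsect]
  have hflatg : (Algebra.TensorProduct.map (AlgHom.id R κ) g).toRingHom.Flat := by
    have heq : (Algebra.TensorProduct.map (AlgHom.id R κ) g).toRingHom =
        eX.symm.toRingHom.comp ((fs.appLE _ _ hle).hom.comp eY.toRingHom) := by
      refine RingHom.ext fun z => ?_
      simp only [RingHom.comp_apply, AlgHom.toRingHom_eq_coe, RingHom.coe_coe,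
        RingEquiv.toRingHom_eq_coe, hsq, RingEquiv.symm_apply_apply]
    rw [heq]
    exact (RingHom.Flat.comp (RingHom.Flat.comp (.of_bijective eY.bijective) hflat_s)
      (.of_bijective eX.symm.bijective))
  -- the fibre hypothesis of Tag 05UV
  have hker : maximalIdeal R = RingHom.ker (Algebra.ofId R κ : R →+* κ) :=
    (IsLocalRing.eq_maximalIdeal (RingHom.ker_isMaximal_of_surjective (algebraMap R κ) hκ)).symm
  let e : (R ⧸ maximalIdeal R) ≃ₐ[R] κ :=
    (Ideal.quotientEquivAlgOfEq R hker).trans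
      (Ideal.quotientKerAlgEquivOfSurjective (f := Algebra.ofId R κ) hκ)
  have hfib := flat_quotient_tensor_of_flat_tensor_map (maximalIdeal R) e hflatg
  -- the prime of `x` contains `𝔪 B'`
  have hq' : (maximalIdeal R).map (algebraMap R (ChartRing X.hom U)) ≤
      (hU.primeIdealOf ⟨x, hxU⟩).asIdeal := by
    rw [Ideal.map_le_iff_le_comap]
    intro r hr
    -- `algebraMap R B' r = X.hom^♯(r)|_U`; its germ at `x` is a non-unit since `x ↦ closedPoint R`
    rw [Ideal.mem_comap]
    change ChartRing.mk X.hom U (X.hom.appLE ⊤ U le_top ((Scheme.ΓSpecIso (.of R)).inv r)) ∈ _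
    have hmem : (Scheme.ΓSpecIso (.of R)).inv r ∈
        ((hU.primeIdealOf ⟨x, hxU⟩).comap (X.hom.appLE ⊤ U le_top).hom).asIdeal →
        ChartRing.mk X.hom U (X.hom.appLE ⊤ U le_top ((Scheme.ΓSpecIso (.of R)).inv r)) ∈
          (hU.primeIdealOf ⟨x, hxU⟩).asIdeal := fun h => h
    apply hmem
    rw [IsAffineOpen.comap_primeIdealOf_appLE ⊤ (isAffineOpen_top _) U hU le_top hxU]
    -- now a statement about `Spec R`: the section `r` lies in the prime of the closed point
    have hxt : X.hom x ∈ (⊤ : (Spec (CommRingCat.of R)).Opens) := (le_top : U ≤ X.hom ⁻¹ᵁ ⊤) hxU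
    letI := (Spec (CommRingCat.of R)).presheaf.algebra_section_stalk
      (⟨X.hom x, hxt⟩ : (⊤ : (Spec (CommRingCat.of R)).Opens))
    haveI := (isAffineOpen_top (Spec (CommRingCat.of R))).isLocalization_stalk ⟨X.hom x, hxt⟩
    refine (IsLocalization.AtPrime.to_map_mem_maximal_iff
      ((Spec (CommRingCat.of R)).presheaf.stalk (X.hom x))
      ((isAffineOpen_top (Spec (CommRingCat.of R))).primeIdealOf ⟨X.hom x, hxt⟩).asIdeal
      ((Scheme.ΓSpecIso (.of R)).inv r)).mp ?_
    rw [IsLocalRing.mem_maximalIdeal, mem_nonunits_iff]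
    change ¬ IsUnit ((Spec (CommRingCat.of R)).presheaf.germ ⊤ (X.hom x) hxt
      ((Scheme.ΓSpecIso (.of R)).inv r))
    rw [← Scheme.mem_basicOpen, basicOpen_eq_of_affine, hx]
    exact fun h => (PrimeSpectrum.mem_basicOpen _ _).mp h hr
  have h05 := Literature.RingTheory.Flat.Stacks05UV_holds R (ChartRing Y.hom V) (ChartRing X.hom U)
    hFT hFP hFl hfib (hU.primeIdealOf ⟨x, hxU⟩).asIdeal hq'
  -- transport to the stalk map
  have hloc := flat_localRingHom_of_flat (B := ChartRing Y.hom V) (B' := ChartRing X.hom U)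
    (hU.primeIdealOf ⟨x, hxU⟩).asIdeal (hV.primeIdealOf ⟨f.left x, hUV hxU⟩).asIdeal
    (congr($(IsAffineOpen.comap_primeIdealOf_appLE V hV U hU hUV hxU).1).symm) h05
  haveI := RingHom.toMorphismProperty_respectsIso_iff.mp RingHom.Flat.respectsIso
  exact (MorphismProperty.arrow_mk_iso_iff (RingHom.toMorphismProperty RingHom.Flat)
    (IsAffineOpen.arrowStalkMapIso f.left V hV U hU hUV hxU)).mpr hloc

/-! ## §2 Points over an open part of the base -/

/-- **Flatness over an open part of the base is flatness of the base change.**  Let `g : S' → S` be an open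
immersion and `f : X → Y` a morphism of `S`-schemes whose base change `X ×_S S' → Y ×_S S'` is flat.  Then
the stalk map of `f` is flat at every point of `X` lying over the image of `g` (the two projections
`X ×_S S' → X`, `Y ×_S S' → Y` are open immersions, so their stalk maps are isomorphisms).  Private
plumbing for `flat_of_flat_fibres`. [folklore] -/
private theorem flat_stalkMap_of_flat_pullback_of_isOpenImmersion {S S' : Scheme.{u}} (g : S' ⟶ S)
    [IsOpenImmersion g] {X Y : Over S} (f : X ⟶ Y) [Flat ((Over.pullback g).map f).left]
    (x : X.left) (hx : X.hom x ∈ Set.range g) : (f.left.stalkMap x).hom.Flat := by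
  have hx' : x ∈ Set.range (pullback.fst X.hom g) := by
    rw [Scheme.Pullback.range_fst]; exact hx
  obtain ⟨x', rfl⟩ := hx'
  have hfs₁ : ((Over.pullback g).map f).left ≫ pullback.fst Y.hom g = pullback.fst X.hom g ≫ f.left :=
    pullback.lift_fst _ _ _
  -- `(fs ≫ pr_Y)^♯_{x'} = fs^♯_{x'} ∘ (pr_Y)^♯` is flat (`pr_Y` is an open immersion)
  have h1 : ((((Over.pullback g).map f).left ≫ pullback.fst Y.hom g).stalkMap x').hom.Flat := by
    rw [Scheme.Hom.stalkMap_comp, CommRingCat.hom_comp]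
    exact (RingHom.Flat.of_bijective (ConcreteCategory.bijective_of_isIso _)).comp
      (Flat.stalkMap _ x')
  -- hence so is `(pr_X ≫ f)^♯_{x'} = (pr_X)^♯_{x'} ∘ f^♯_{pr_X x'}`
  have h2 : ((pullback.fst X.hom g ≫ f.left).stalkMap x').hom.Flat := by
    rw [Scheme.Hom.stalkMap_congr_hom _ _ hfs₁.symm x', CommRingCat.hom_comp]
    exact (RingHom.Flat.of_bijective (ConcreteCategory.bijective_of_isIso _)).comp h1
  -- and `(pr_X)^♯_{x'}` is invertible
  have h3 : f.left.stalkMap (pullback.fst X.hom g x') =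
      (pullback.fst X.hom g ≫ f.left).stalkMap x' ≫ inv ((pullback.fst X.hom g).stalkMap x') := by
    rw [Scheme.Hom.stalkMap_comp, Category.assoc, IsIso.hom_inv_id, Category.comp_id]
  rw [h3, CommRingCat.hom_comp]
  exact h2.comp (RingHom.Flat.of_bijective (ConcreteCategory.bijective_of_isIso _))

/-! ## §3 Both fibres: discrete valuation rings and the like -/

/-- **The points of `Spec R` for a local domain of dimension `≤ 1`** (e.g. a discrete valuation ring) with
fraction field `K`: every point is the closed point or lies in the image of the generic point
`Spec K → Spec R`.  Private plumbing for `flat_of_flat_fibres`. [folklore] -/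
private theorem eq_closedPoint_or_mem_range_specMap {R : Type u} [CommRing R] [IsDomain R] [IsLocalRing R]
    [Ring.DimensionLEOne R] (K : Type u) [CommRing K] [Algebra R K] [IsFractionRing R K]
    (p : PrimeSpectrum R) :
    p = closedPoint R ∨
      p ∈ Set.range (Spec.map (CommRingCat.ofHom (algebraMap R K)) : Spec (.of K) → Spec (.of R)) := by
  by_cases hp : p.asIdeal = ⊥
  · right
    haveI : IsDomain K := IsFractionRing.isDomain R
    refine ⟨⟨⊥, Ideal.isPrime_bot⟩, PrimeSpectrum.ext ?_⟩
    change Ideal.comap (algebraMap R K) ⊥ = p.asIdeal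
    rw [hp, Ideal.comap_bot_of_injective _ (IsFractionRing.injective R K)]
  · left
    exact PrimeSpectrum.ext
      (IsLocalRing.eq_maximalIdeal (Ideal.IsPrime.isMaximal inferInstance hp))

/-- **Flatness from flatness of both fibres over a discrete valuation ring** (and, more generally, over a
local domain `R` of dimension `≤ 1` whose generic point `Spec K → Spec R`, `K = Frac R`, is an open
immersion — for a discrete valuation ring this is the tree's `isOpenImmersion_specGenericPoint`).  Let
`R → κ` be a surjection onto a field (a model of the residue field).  For `f : X → Y` over `Spec R` with `Y`
locally of finite type and `X` flat and locally of finite presentation over `R`: if both fibre maps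
`X ×_R κ → Y ×_R κ` and `X ×_R K → Y ×_R K` are flat, then `f` is flat — EGA IV₃ 11.3.10 at the closed
point (`flat_stalkMap_of_flat_closedFibre`), while over the open generic point flatness is that of the
base change. [cite: EGAIV3, Thm. 11.3.10] [cite: StacksProject, Tag 05UV] -/
theorem flat_of_flat_fibres [IsDomain R] [Ring.DimensionLEOne R] (hκ : Function.Surjective (algebraMap R κ))
    (K : Type u) [CommRing K] [Algebra R K] [IsFractionRing R K]
    [IsOpenImmersion (Spec.map (CommRingCat.ofHom (algebraMap R K)))]
    {X Y : Over (Spec (CommRingCat.of R))} (f : X ⟶ Y)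
    [LocallyOfFiniteType Y.hom] [LocallyOfFinitePresentation X.hom] [Flat X.hom]
    [Flat ((Over.pullback (Spec.map (CommRingCat.ofHom (algebraMap R κ)))).map f).left]
    [Flat ((Over.pullback (Spec.map (CommRingCat.ofHom (algebraMap R K)))).map f).left] :
    Flat f.left := by
  refine Flat.of_stalkMap _ fun x => ?_
  rcases eq_closedPoint_or_mem_range_specMap K (X.hom x) with hx | hx
  · exact flat_stalkMap_of_flat_closedFibre hκ f x hx
  · exact flat_stalkMap_of_flat_pullback_of_isOpenImmersion _ f x hx

end Literature.AlgebraicGeometry.Morphisms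

end
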